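import Literature.NumberTheory.Sieve.CircleMethod
import HarnessLib

/-!
# Circle method: the binary Goldbach integral identity (proof)

Topic `Literature/NumberTheory/Sieve`, companion ("Proofs") file of `CircleMethod.lean`, kept
separate so that the statement file keeps its imports and its review queue. It discharges the named
fact `Literature.NumberTheory.Sieve.weightedGoldbachCount_eq_integral` of `CircleMethod.lean`:

  `∑_{m + n = N} Λ(m) Λ(n) = ∫₀¹ S(α)² e(−Nα) dα`,  `S(α) = ∑_{1 ≤ n ≤ N} Λ(n) e(nα)`.

## Source

R. C. Vaughan, *The Hardy–Littlewood Method*, 2nd ed., Cambridge Tracts in Mathematics 125,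
Cambridge University Press (1997) [VaughanHL1997]:

* §1.2, eq. (1.8): the orthogonality relation `∫₀¹ e(αh) dα = [h = 0]` (`h ∈ ℤ`), and eq. (1.9):
  `∫₀¹ f(α)^s e(−αn) dα = R_s(n)`, the number of representations counted by the coefficients of
  `f^s` — the general pattern of which the present identity is the case `s = 2` with von Mangoldt
  weights;
* §3.2, eqs. (3.16)–(3.19): for binary Goldbach, `R₁(m) = ∫_𝔘 f(α)² e(−αm) dα` over a unit
  interval `𝔘`, split as `R₂(m) + R₃(m)` (major plus minor arcs). Vaughan weights primes by
  `log p`; the `Λ`-weighted sum `S(α)` used in `CircleMethod.lean` is the variant of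
  Iwaniec–Kowalski, *Analytic Number Theory*, §19.1, with the identical (finite, elementary) proof.

## Proof

Extend `S` to `0 ≤ n ≤ N` (`Λ 0 = 0`), expand `S(α)² e(−Nα)` into the finite double sum
`∑_{m,n ≤ N} Λ(m) Λ(n) e((m + n − N)α)`, exchange the finite sum with the interval integral, apply the
already discharged orthogonality fact `Literature.NumberTheory.Sieve.integral_fourierChar_intCast_holds` (eq. (1.8)) to each
term, and collapse the Kronecker delta `[m + n = N]` onto `Finset.antidiagonal N`. No new
definitions; axioms `propext`, `Classical.choice`, `Quot.sound` only.
-/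

noncomputable section

open scoped FourierTransform ArithmeticFunction

open Finset MeasureTheory ArithmeticFunction

namespace Literature.NumberTheory.Sieve

/-- **Discharge** of `weightedGoldbachCount_eq_integral`:
`∑_{m + n = N} Λ(m) Λ(n) = ∫₀¹ S(α)² e(−Nα) dα`. This is Vaughan, *The Hardy–Littlewood Method*,
2nd ed., §3.2, eqs. (3.16)–(3.19): `R₁(m) = ∫_𝔘 f(α)² e(−αm) dα = R₂(m) + R₃(m)` (major plus minor
arcs, `𝔘` a unit interval), an instance of the general pattern §1.2, eq. (1.9),
`∫₀¹ f(α)^s e(−αn) dα = R_s(n)`, deduced there from the orthogonality relation (1.8). Vaughan weights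
primes by `log p`; the `Λ`-weighted form stated here is Iwaniec–Kowalski §19.1 and has the identical
proof: extend `S` to `0 ≤ n ≤ N` (`Λ 0 = 0`), expand the square, exchange the finite double sum with
the integral, apply `integral_fourierChar_intCast_holds` to `e((m + n − N)α)`, and collapse the
Kronecker delta onto `Finset.antidiagonal N`.
[cite: VaughanHL1997, §3.2 eqs. (3.16)–(3.19); §1.2 eqs. (1.8)–(1.9)] -/
theorem weightedGoldbachCount_eq_integral_holds : weightedGoldbachCount_eq_integral := by
  intro N
  set R := range (N + 1) with hR
  -- extend the range of summation to `0 ≤ n ≤ N` (harmless since `Λ 0 = 0`)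
  have hS : ∀ α : ℝ, primeExpSum N α = ∑ n ∈ R, (Λ n : ℂ) * (𝐞 (n * α) : ℂ) := by
    intro α
    rw [primeExpSum, hR, Nat.range_succ_eq_Icc_zero, Icc_eq_cons_Ioc (Nat.zero_le N), sum_cons,
      ← Finset.Icc_add_one_left_eq_Ioc, zero_add]
    simp
  -- expand the integrand into a double sum of characters
  have hI : ∀ α : ℝ, primeExpSum N α ^ 2 * (𝐞 (-(N * α)) : ℂ) =
      ∑ m ∈ R, ∑ n ∈ R, (Λ m : ℂ) * Λ n * (𝐞 (((m + n - N : ℤ)) * α) : ℂ) := by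
    intro α
    rw [hS, sq, sum_mul_sum, sum_mul]
    refine sum_congr rfl fun m _ ↦ ?_
    rw [sum_mul]
    refine sum_congr rfl fun n _ ↦ ?_
    have harg : (((2 * Real.pi * ((m + n - N : ℤ) * α) : ℝ) : ℂ) * Complex.I) =
        ((2 * Real.pi * (m * α) : ℝ) : ℂ) * Complex.I + ((2 * Real.pi * (n * α) : ℝ) : ℂ) *
          Complex.I + ((2 * Real.pi * (-(N * α)) : ℝ) : ℂ) * Complex.I := by
      push_cast
      ring
    simp only [Real.fourierChar_apply]
    rw [harg, Complex.exp_add, Complex.exp_add]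
    ring
  simp_rw [hI]
  have hcont : ∀ (m n : ℕ), IntervalIntegrable
      (fun α : ℝ ↦ (Λ m : ℂ) * Λ n * (𝐞 (((m + n - N : ℤ)) * α) : ℂ)) volume 0 1 := by
    intro m n
    apply Continuous.intervalIntegrable
    fun_prop
  rw [intervalIntegral.integral_finsetSum fun m _ ↦
    Continuous.intervalIntegrable (by fun_prop) _ _]
  rw [sum_congr rfl fun m _ ↦ intervalIntegral.integral_finsetSum fun n _ ↦ hcont m n]
  have horth : ∀ k : ℤ, ∫ α in (0 : ℝ)..1, (𝐞 (k * α) : ℂ) = if k = 0 then 1 else 0 :=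
    integral_fourierChar_intCast_holds
  simp_rw [intervalIntegral.integral_const_mul, horth]
  -- collapse the Kronecker delta
  rw [weightedGoldbachCount]
  push_cast
  rw [Finset.Nat.sum_antidiagonal_eq_sum_range_succ_mk]
  refine (sum_congr rfl fun m hm ↦ ?_).symm
  dsimp only
  have hm' : m ≤ N := Nat.lt_succ_iff.mp (mem_range.mp hm)
  have hiff : ∀ n : ℕ, ((m + n - N : ℤ) = 0) ↔ N - m = n := by omega
  simp_rw [mul_ite, mul_one, mul_zero, hiff, sum_ite_eq]
  rw [if_pos (mem_range.mpr (by omega))]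

end Literature.NumberTheory.Sieve
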